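import Summits.RiemannHypothesis.RiemannHypothesis.Theorems.WeilFormatCCinfExactTables
import HarnessLib

/-!
# Format C, design C∞ (E2 data side): stage T — weighted products `Σ_t g_p(t) h_{p'}(t) v_t` of two claimed tables

Route context: Fourier–Galerkin / Schur-complement certificates of Weil positivity on a window ("format C", C∞ door;
cell memo `run/shared/lean/pub/rh-explicit/rh-explicit-weil-2/gen15/E2-PLAN-v2.md` §6 and the gen16 layout of record,
HOME STATUS 2026-08-25 «weil-2 gen16 STATUS 0/1»; supporting stmt-RiemannHypothesis-0098; seat rh-explicit-weil-2).

The heavy kernel objects of the C∞ certificate matrix are weighted product sums of two real tables over a common column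
index: the middle Gram of the resolved columns `T(p,p') = Σ_{t<Nm} g(p,t)·g(p',t)·v_t` (`v_t = 1/w(B+t)` the generator's
dyadic reciprocal weights), and the Hankel quadratic part `Σ_f A(p,f)·(G·A)(p',f)·1 + Σ_f A(p,f)·A(p',f)·c_f`.  This stage is
GENERIC in two real tables `g` (`n₁` rows) and `h` (`n₂` rows) of width `Nm` and exact natural weights:

* input: claimed tables `CinfExact.TabNear g n₁ Nm cg ρg GZ`, `CinfExact.TabNear h n₂ Nm cg ρh HZ` (same scale) and exact
  weights `v t = VW[t]/2^cv`;
* kernel work: `CinfStageT.rowT GZ HZ VW n₂ p` = the exact integer row `(dotZ3 GZ[p] HZ[p'] VW)_{p'<n₂}` (GMP multiply-adds,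
  no interval arithmetic), compared with the CLAIMED table `TZ` at scale `cT = 2cg + cv − k` by `|T̄ − TZ·2^k| ≤ 2^k` in row
  bands (`checkTrows`, each band its own kernel file, glued by `TRows.zero/extend`), plus scalar checks (shapes; row masses
  `Σ_t VW[t]·|GZ[p][t]| ≤ SA`, `Σ_t VW[t]·|HZ[p'][t]| ≤ SB`; budget `ρh·SA + ρg·SB + ρg·ρh·ΣVW + 2^k ≤ ρT·2^k`);
* output: `CinfExact.TabNear (CinfStageT.TgenR g h v Nm) n₁ n₂ cT ρT TZ` (`stageT_tabNear`) — the analytic radius is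
  carried by `CinfExact.abs_sum_mul3_sub_le`.

The sector files identify `TgenR` with the door's `Σ_{m ∈ Ico B m₀} … / w m` blocks (`h = g`) and with the two Hankel sums.
Standard axioms; no RH claim.
-/

set_option autoImplicit false
-- `Summit.RiemannHypothesis.RiemannHypothesis.…` is the layout-mandated namespace (summit = problem name).
set_option linter.dupNamespace false

open Finset

namespace Summit.RiemannHypothesis.RiemannHypothesis.Theorems.WeilFormatC

open Literature.NumberTheory.LFunctions (PsdDyadic.getMZ)

namespace CinfStageT

/-! ## The real object -/

/-- The generic weighted product table `T(p,p') = Σ_{t<Nm} g(p,t) h(p',t) v(t)`. -/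
noncomputable def TgenR (g h : ℕ → ℕ → ℝ) (v : ℕ → ℝ) (Nm : ℕ) (p p' : ℕ) : ℝ :=
  ∑ t ∈ range Nm, g p t * h p' t * v t

/-! ## The integer computation and the checks -/

/-- Row `p` of the exact integer table: `(dotZ3 GZ[p] HZ[p'] VW)_{p' < n₂}` (scale `2^(2cg+cv)`). -/
def rowT (GZ HZ : List (List ℤ)) (VWZ : List ℤ) (n₂ p : ℕ) : List ℤ :=
  (List.range n₂).map fun p' ↦ CinfExact.dotZ3 (GZ.getD p []) (HZ.getD p' []) VWZ

/-- `|x − y·2^k| ≤ 2^k` entrywise for two integer lists of equal length. -/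
def nearShiftL (k : ℕ) : List ℤ → List ℤ → Bool
  | [], [] => true
  | x :: xs, y :: ys => decide (|x - y * 2 ^ k| ≤ 2 ^ k) && nearShiftL k xs ys
  | _, _ => false

/-- Specification of `nearShiftL`. -/
theorem nearShiftL_spec {k : ℕ} : ∀ {xs ys : List ℤ}, nearShiftL k xs ys = true →
    ys.length = xs.length ∧ ∀ t < xs.length, |xs.getD t 0 - ys.getD t 0 * 2 ^ k| ≤ 2 ^ k
  | [], [], _ => by simp
  | [], _ :: _, h => by simp [nearShiftL] at h
  | _ :: _, [], h => by simp [nearShiftL] at h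
  | x :: xs, y :: ys, h => by
      simp only [nearShiftL, Bool.and_eq_true, decide_eq_true_eq] at h
      obtain ⟨hl, hi⟩ := nearShiftL_spec h.2
      refine ⟨by simp [hl], fun t ht ↦ ?_⟩
      cases t with
      | zero => simpa using h.1
      | succ t => simp only [List.getD_cons_succ]; exact hi t (by simpa using ht)

/-- **Band check**: for `p ∈ [p₀, p₀+kb)`, the claimed row `TZ[p]` is the computed row up to the rounding shift `k`. -/
def checkTrows (GZ HZ : List (List ℤ)) (VWZ : List ℤ) (n₂ k : ℕ) (TZ : List (List ℤ)) (p₀ kb : ℕ) : Bool :=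
  CinfExact.allFromTo p₀ kb fun p ↦ nearShiftL k (rowT GZ HZ VWZ n₂ p) (TZ.getD p [])

/-- `TRows … m`: rows below `m` of `TZ` are the computed rows up to the shift. -/
structure TRows (GZ HZ : List (List ℤ)) (VWZ : List ℤ) (n₂ k : ℕ) (TZ : List (List ℤ)) (m : ℕ) : Prop where
  /-- rounding enclosure of every entry of every row below `m` -/
  out : ∀ p < m, ∀ p' < n₂,
    |(rowT GZ HZ VWZ n₂ p).getD p' 0 - PsdDyadic.getMZ TZ p p' * 2 ^ k| ≤ 2 ^ k

/-- Band glue: no rows yet. -/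
theorem TRows.zero {GZ HZ : List (List ℤ)} {VWZ : List ℤ} {n₂ k : ℕ} {TZ : List (List ℤ)} :
    TRows GZ HZ VWZ n₂ k TZ 0 :=
  ⟨fun _ hp ↦ absurd hp (by omega)⟩

/-- **Band glue**: one passing band extends the rows. -/
theorem TRows.extend {GZ HZ : List (List ℤ)} {VWZ : List ℤ} {n₂ k : ℕ} {TZ : List (List ℤ)} {m kb : ℕ}
    (h1 : TRows GZ HZ VWZ n₂ k TZ m) (h2 : checkTrows GZ HZ VWZ n₂ k TZ m kb = true) :
    TRows GZ HZ VWZ n₂ k TZ (m + kb) := by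
  refine ⟨fun p hp p' hp' ↦ ?_⟩
  by_cases hpm : p < m
  · exact h1.out p hpm p' hp'
  · have hb := CinfExact.allFromTo_spec h2 p (by omega) hp
    obtain ⟨-, hnear⟩ := nearShiftL_spec hb
    have hlen : (rowT GZ HZ VWZ n₂ p).length = n₂ := by simp [rowT]
    simpa [PsdDyadic.getMZ] using hnear p' (by rw [hlen]; exact hp')

/-- Shapes: the table has `n` rows of length `Nm`, `VW` has length `Nm`. -/
def checkTShapes (GZ : List (List ℤ)) (VW : List ℕ) (n Nm : ℕ) : Bool :=
  decide (VW.length = Nm) && CinfExact.allFromTo 0 n fun p ↦ decide ((GZ.getD p []).length = Nm)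

/-- Row masses: `Σ_t VW[t]·|GZ[p][t]| ≤ SA` for every row `p < n`. -/
def checkTMass (GZ : List (List ℤ)) (VW : List ℕ) (n SA : ℕ) : Bool :=
  CinfExact.allFromTo 0 n fun p ↦ decide (CinfExact.absDotN VW (GZ.getD p []) ≤ SA)

/-- **Budget**: `ρh·SA + ρg·SB + ρg·ρh·ΣVW + 2^k ≤ ρT·2^k` (the perturbation bound plus one rounding ulp fit in the claimed
radius; `SA` bounds the `g`-row masses, `SB` the `h`-row masses). -/
def checkTBudget (VW : List ℕ) (ρg ρh SA SB k ρT : ℕ) : Bool :=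
  decide (ρh * SA + ρg * SB + ρg * ρh * CinfExact.sumN VW + 2 ^ k ≤ ρT * 2 ^ k)

/-! ## Soundness -/

/-- The weights as an integer list. -/
def toZ : List ℕ → List ℤ
  | [] => []
  | v :: vs => (v : ℤ) :: toZ vs

/-- Entries of `toZ`. -/
private theorem getD_toZ : ∀ (VW : List ℕ) (t : ℕ), ((toZ VW).getD t 0 : ℝ) = ((VW.getD t 0 : ℕ) : ℝ)
  | [], t => by simp [toZ]
  | v :: vs, 0 => by simp [toZ]
  | v :: vs, t + 1 => by simpa [toZ] using getD_toZ vs t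

/-- Length of `toZ`. -/
private theorem length_toZ : ∀ (VW : List ℕ), (toZ VW).length = VW.length
  | [] => rfl
  | v :: vs => by simp [toZ, length_toZ vs]

/-- **Stage T soundness.**  From the claimed column table (`TabNear g n Nm cg ρg GZ`), exact dyadic weights, the shape /
mass / budget checks and the row bands (`TRows … n`), the claimed Gram table holds:
`TabNear (TgenR g v Nm) n n cT ρT TZ` with `cT + k = 2cg + cv`. -/
theorem stageT_tabNear {g h : ℕ → ℕ → ℝ} {v : ℕ → ℝ} {n₁ n₂ Nm cg ρg ρh cv cT k ρT SA SB : ℕ}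
    {GZ HZ TZ : List (List ℤ)} {VW : List ℕ}
    (hg : CinfExact.TabNear g n₁ Nm cg ρg GZ) (hh : CinfExact.TabNear h n₂ Nm cg ρh HZ)
    (hv : ∀ t < Nm, v t = ((VW.getD t 0 : ℕ) : ℝ) / 2 ^ cv)
    (hshapeG : checkTShapes GZ VW n₁ Nm = true) (hshapeH : checkTShapes HZ VW n₂ Nm = true)
    (hmassG : checkTMass GZ VW n₁ SA = true) (hmassH : checkTMass HZ VW n₂ SB = true)
    (hbudget : checkTBudget VW ρg ρh SA SB k ρT = true) (hcT : cT + k = 2 * cg + cv)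
    (hrows : TRows GZ HZ (toZ VW) n₂ k TZ n₁) :
    CinfExact.TabNear (TgenR g h v Nm) n₁ n₂ cT ρT TZ := by
  -- unpack the Boolean checks
  simp only [checkTShapes, Bool.and_eq_true, decide_eq_true_eq] at hshapeG hshapeH
  obtain ⟨hVW, hGZ⟩ := hshapeG
  obtain ⟨-, hHZ⟩ := hshapeH
  have hlenG : ∀ p < n₁, (GZ.getD p []).length = Nm := fun p hp ↦ by
    have := CinfExact.allFromTo_spec hGZ p (Nat.zero_le _) (by simpa using hp)
    rwa [decide_eq_true_eq] at this
  have hlenH : ∀ p < n₂, (HZ.getD p []).length = Nm := fun p hp ↦ by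
    have := CinfExact.allFromTo_spec hHZ p (Nat.zero_le _) (by simpa using hp)
    rwa [decide_eq_true_eq] at this
  have hSA : ∀ p < n₁, (CinfExact.absDotN VW (GZ.getD p []) : ℝ) ≤ SA := fun p hp ↦ by
    have := CinfExact.allFromTo_spec hmassG p (Nat.zero_le _) (by simpa using hp)
    rw [decide_eq_true_eq] at this
    exact_mod_cast this
  have hSB : ∀ p < n₂, (CinfExact.absDotN VW (HZ.getD p []) : ℝ) ≤ SB := fun p hp ↦ by
    have := CinfExact.allFromTo_spec hmassH p (Nat.zero_le _) (by simpa using hp)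
    rw [decide_eq_true_eq] at this
    exact_mod_cast this
  simp only [checkTBudget, decide_eq_true_eq] at hbudget
  have hbud : (ρh * SA + ρg * SB + ρg * ρh * CinfExact.sumN VW + 2 ^ k : ℝ) ≤ ρT * 2 ^ k := by exact_mod_cast hbudget
  -- positivity facts
  have h2cg : (0 : ℝ) < 2 ^ cg := by positivity
  have h2cv : (0 : ℝ) < 2 ^ cv := by positivity
  have h2k : (0 : ℝ) < 2 ^ k := by positivity
  have h2cT : (0 : ℝ) < 2 ^ cT := by positivity
  have hpow : (2 : ℝ) ^ cT * 2 ^ k = 2 ^ cg * 2 ^ cg * 2 ^ cv := by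
    rw [← pow_add, hcT, ← pow_add, ← pow_add]; ring_nf
  refine ⟨fun p hp p' hp' ↦ ?_⟩
  -- abbreviations: midpoints and weights as real sequences
  set xb : ℕ → ℝ := fun t ↦ ((GZ.getD p []).getD t 0 : ℝ) / 2 ^ cg with hxb
  set yb : ℕ → ℝ := fun t ↦ ((HZ.getD p' []).getD t 0 : ℝ) / 2 ^ cg with hyb
  have hx : ∀ t < Nm, |g p t - xb t| ≤ (ρg : ℝ) / 2 ^ cg := fun t ht ↦ by
    simpa [hxb, PsdDyadic.getMZ] using hg.out p hp t ht
  have hy : ∀ t < Nm, |h p' t - yb t| ≤ (ρh : ℝ) / 2 ^ cg := fun t ht ↦ by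
    simpa [hyb, PsdDyadic.getMZ] using hh.out p' hp' t ht
  have hvnn : ∀ t < Nm, 0 ≤ v t := fun t ht ↦ by rw [hv t ht]; positivity
  -- (1) perturbation: |T − T̄| ≤ ηy Σ v|xb| + ηx Σ v|yb| + ηx ηy Σ v
  have hpert := CinfExact.abs_sum_mul3_sub_le (k := Nm) (v := v) (x := g p) (y := h p') hvnn hx hy
  -- (2) the midpoint sum is the integer dot product
  have hmid : ∑ t ∈ range Nm, xb t * yb t * v t
      = (CinfExact.dotZ3 (GZ.getD p []) (HZ.getD p' []) (toZ VW) : ℝ) / (2 ^ cg * 2 ^ cg * 2 ^ cv) := by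
    rw [CinfExact.dotZ3_eq_sum _ _ _ Nm (hlenG p hp) (hlenH p' hp') (by rw [length_toZ, hVW]), Finset.sum_div]
    refine Finset.sum_congr rfl fun t ht ↦ ?_
    rw [hxb, hyb, hv t (Finset.mem_range.1 ht), getD_toZ]
    field_simp
  -- (3) the mass sums
  have hmassx : ∑ t ∈ range Nm, v t * |xb t| ≤ (SA : ℝ) / (2 ^ cv * 2 ^ cg) := by
    have e : ∑ t ∈ range Nm, v t * |xb t| = (CinfExact.absDotN VW (GZ.getD p []) : ℝ) / (2 ^ cv * 2 ^ cg) := by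
      rw [CinfExact.absDotN_eq_sum _ _ Nm hVW (hlenG p hp), Finset.sum_div]
      refine Finset.sum_congr rfl fun t ht ↦ ?_
      rw [hxb, hv t (Finset.mem_range.1 ht), abs_div, abs_of_pos h2cg]
      field_simp
    rw [e]; exact div_le_div_of_nonneg_right (hSA p hp) (by positivity)
  have hmassy : ∑ t ∈ range Nm, v t * |yb t| ≤ (SB : ℝ) / (2 ^ cv * 2 ^ cg) := by
    have e : ∑ t ∈ range Nm, v t * |yb t| = (CinfExact.absDotN VW (HZ.getD p' []) : ℝ) / (2 ^ cv * 2 ^ cg) := by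
      rw [CinfExact.absDotN_eq_sum _ _ Nm hVW (hlenH p' hp'), Finset.sum_div]
      refine Finset.sum_congr rfl fun t ht ↦ ?_
      rw [hyb, hv t (Finset.mem_range.1 ht), abs_div, abs_of_pos h2cg]
      field_simp
    rw [e]; exact div_le_div_of_nonneg_right (hSB p' hp') (by positivity)
  have hsumv : ∑ t ∈ range Nm, v t = (CinfExact.sumN VW : ℝ) / 2 ^ cv := by
    rw [CinfExact.sumN_eq_sum _ Nm hVW, Finset.sum_div]
    exact Finset.sum_congr rfl fun t ht ↦ hv t (Finset.mem_range.1 ht)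
  -- (4) the rounding enclosure of the claim
  have hround := hrows.out p hp p' hp'
  have hrow : ((rowT GZ HZ (toZ VW) n₂ p).getD p' 0 : ℝ)
      = (CinfExact.dotZ3 (GZ.getD p []) (HZ.getD p' []) (toZ VW) : ℝ) := by
    rw [rowT, List.getD_eq_getElem?_getD, List.getElem?_map, List.getElem?_range hp']; rfl
  have hround' : |(CinfExact.dotZ3 (GZ.getD p []) (HZ.getD p' []) (toZ VW) : ℝ)
      - (PsdDyadic.getMZ TZ p p' : ℝ) * 2 ^ k| ≤ 2 ^ k := by
    rw [← hrow]; exact_mod_cast hround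
  -- (5) assemble
  have hηx0 : (0 : ℝ) ≤ (ρg : ℝ) / 2 ^ cg := by positivity
  have step1 : |TgenR g h v Nm p p' - ∑ t ∈ range Nm, xb t * yb t * v t|
      ≤ (ρh * SA + ρg * SB + ρg * ρh * CinfExact.sumN VW : ℝ) / (2 ^ cg * 2 ^ cg * 2 ^ cv) := by
    refine hpert.trans ?_
    have e : (ρh * SA + ρg * SB + ρg * ρh * CinfExact.sumN VW : ℝ) / (2 ^ cg * 2 ^ cg * 2 ^ cv)
        = (ρh : ℝ) / 2 ^ cg * ((SA : ℝ) / (2 ^ cv * 2 ^ cg)) + (ρg : ℝ) / 2 ^ cg * ((SB : ℝ) / (2 ^ cv * 2 ^ cg))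
          + (ρg : ℝ) / 2 ^ cg * ((ρh : ℝ) / 2 ^ cg) * ((CinfExact.sumN VW : ℝ) / 2 ^ cv) := by
      field_simp
    rw [e, hsumv]
    gcongr
  have step2 : |∑ t ∈ range Nm, xb t * yb t * v t - (PsdDyadic.getMZ TZ p p' : ℝ) / 2 ^ cT|
      ≤ (2 : ℝ) ^ k / (2 ^ cg * 2 ^ cg * 2 ^ cv) := by
    rw [hmid]
    have e : (CinfExact.dotZ3 (GZ.getD p []) (HZ.getD p' []) (toZ VW) : ℝ) / (2 ^ cg * 2 ^ cg * 2 ^ cv)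
        - (PsdDyadic.getMZ TZ p p' : ℝ) / 2 ^ cT
        = ((CinfExact.dotZ3 (GZ.getD p []) (HZ.getD p' []) (toZ VW) : ℝ) - (PsdDyadic.getMZ TZ p p' : ℝ) * 2 ^ k)
          / (2 ^ cg * 2 ^ cg * 2 ^ cv) := by
      rw [← hpow]; field_simp
    rw [e, abs_div, abs_of_pos (by positivity : (0 : ℝ) < 2 ^ cg * 2 ^ cg * 2 ^ cv)]
    exact div_le_div_of_nonneg_right hround' (by positivity)
  have hfin : (ρh * SA + ρg * SB + ρg * ρh * CinfExact.sumN VW : ℝ) / (2 ^ cg * 2 ^ cg * 2 ^ cv)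
      + (2 : ℝ) ^ k / (2 ^ cg * 2 ^ cg * 2 ^ cv) ≤ (ρT : ℝ) / 2 ^ cT := by
    rw [← add_div, div_le_div_iff₀ (by positivity) h2cT]
    calc (ρh * SA + ρg * SB + ρg * ρh * CinfExact.sumN VW + (2 : ℝ) ^ k) * 2 ^ cT
        ≤ (ρT : ℝ) * 2 ^ k * 2 ^ cT := by gcongr
      _ = (ρT : ℝ) * (2 ^ cg * 2 ^ cg * 2 ^ cv) := by rw [← hpow]; ring
  calc |TgenR g h v Nm p p' - (PsdDyadic.getMZ TZ p p' : ℝ) / 2 ^ cT|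
      ≤ |TgenR g h v Nm p p' - ∑ t ∈ range Nm, xb t * yb t * v t|
        + |∑ t ∈ range Nm, xb t * yb t * v t - (PsdDyadic.getMZ TZ p p' : ℝ) / 2 ^ cT| := abs_sub_le _ _ _
    _ ≤ _ := add_le_add step1 step2
    _ ≤ (ρT : ℝ) / 2 ^ cT := hfin

end CinfStageT

end Summit.RiemannHypothesis.RiemannHypothesis.Theorems.WeilFormatC
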